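import Literature.NumberTheory.Automorphic.CongruenceSubgroupPropertySL2Proofs
import Mathlib.NumberTheory.ModularForms.CongruenceSubgroups
import Mathlib.Data.ZMod.Units
import Mathlib.Tactic.LinearCombination
import HarnessLib

/-!
# Crux `X11aLowerHalf` (item stmt-BirchSwinnertonDyer-19064), stub `stub_muAnSurjDeepFive` side — the CUSPIDAL
# CHARACTERS OF `Γ₀(N)` HAVE NON-CONGRUENCE KERNELS («Lemma E», Kurth–Long 2008 Prop. 3.2 in `Γ₀`-form), fact-free

Cell `bsd-print-x11a`, width seat bsd-line-x11a-p1-w2 g4 (`--supports stmt-BirchSwinnertonDyer-19064`).  BSD is not proved by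
any of this; nothing is asserted about any curve; PARTITION 0.  Pure group theory over Mathlib's `CongruenceSubgroup.Gamma0 /
Gamma1' / Gamma` and the tree's elementary matrices `SL2Rel.e12 / e21` (cell bsd-f3-mu / Serre-CSP story).

WHY (the line).  After -w2 g3's winding theorem (`Theorems/PrintX11aMultWinding.lean`: SOME even branch of the
Mazur–Tate–Teitelbaum measure at a multiplicative prime has μ = 0) the open input of `stub_muAnSurjDeepFive` (and of U5's rung,
K2's 19948) is BRANCH SEPARATION: the ω⁰ branch = Teichmüller ORBIT SUMS.  The only mechanism proposed on the hub for orbit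
sums (crux idea `fw-solenoid`, bsd-idea-17, `Cruxes/UpperNonSurjFive/Ideas/fw-solenoid.md`; typed statements
`Cruxes/UpperNonSurjFive/FwSolenoidSketch.lean`) splits into an ANALYTIC half (recurrence of the Manin cocycle on the
`p`-power cusps — open) and an ALGEBRAIC half, «NonExtension»: a cuspidal mod-`p` homology character of `Γ₀(pM)` does not
extend to the `p`-arithmetic group `Γ₀(M; ℤ[1/p])`.  NonExtension = Serre's congruence subgroup property for `SL₂(ℤ[1/p])`
(TREE, proved: `SerreSL2Congruence1970_congruenceSubgroupProperty_away_holds`) + THIS FILE's «Lemma E».  This file proves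
Lemma E for EVERY level, image-independent (surjective and non-surjective pairs alike), with no hypothesis:

* `gamma1_le_congruence_sup_closure_parabolics` — **for all `N` and all `L ≥ 1`:
  `Γ₁(N) ⊆ ⟨(1 1; 0 1), (1 0; N 1)⟩ · (Γ₀(N) ∩ Γ(L))`** inside `Γ₀(N)`.  Equivalently: the image of `Γ₁(N)` in
  `SL₂(ℤ/L)` is generated by the images of the two standard parabolics of `Γ₀(N)`.
* `map_eq_one_of_parabolic_of_congruence` — hence a homomorphism `χ : Γ₀(N) → F` (any group `F`) killing the two
  parabolics `T = (1 1; 0 1)`, `V_N = (1 0; N 1)` and the congruence kernel `Γ₀(N) ∩ Γ(L)` of SOME level `L ≥ 1` kills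
  `Γ₁(N)`, i.e. factors through `Γ₀(N)/Γ₁(N) = (ℤ/N)ˣ` («Eisenstein»).  Contrapositive (Kurth–Long's wording): a
  homomorphism of `Γ₀(N)` of parabolic («type II») type whose kernel does not contain `Γ₁(N)` has a NON-CONGRUENCE kernel —
  in particular every cuspidal `𝔽_p`-valued homology character of `X₀(N)` does.  This is exactly bsd-idea-17's typed
  `FwSolenoid.LemmaE N` (whose `IsTypeII` hypothesis — `χ` kills every trace-`±2` element — contains ours).

Proof (elementary; Bass–Vaserstein row reduction over the FINITE ring `ℤ/L`, no CSP): §1 over any commutative ring `R` and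
`n ∈ R`, an element of Vaserstein's `G(R, (n)) = {(a b; c d) : c ≡ a − 1 ≡ d − 1 ≡ 0 (mod n)}` whose corner `a` is a UNIT
lies in `E(R, (n)) = ⟨E₁₂(R), E₂₁((n))⟩` (explicit word: `diag(u,u⁻¹) = E₂₁(−nu⁻¹)E₁₂(y)E₂₁(n)E₁₂(−u⁻¹y)` for `u = 1 + yn`);
§2 in `SL₂(ℤ/L)`, `E(ℤ/L, (N)) = ⟨Ē₁₂(1), Ē₂₁(N)⟩` = the reduction of `⟨T, V_N⟩`; §3 for `γ = (a b; c d) ∈ Γ₁(N)` the corner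
can be made prime to `L` inside the coset `⟨T⟩γ` (`gcd(a, c) = 1`; `a + xc` with `x` = the product of the primes of `L` not
dividing `a`), so `γ ≡ η (mod Γ(L))` for some `η ∈ ⟨T, V_N⟩`.  beyond-print: no (Kurth–Long 2008 Prop. 3.2 / folklore);
new in the tree.  No summit statement is proved by this seat.

References: [KurthLong2008] C. A. Kurth, L. Long, *On modular forms for some noncongruence subgroups of SL₂(ℤ)*,
J. Number Theory 128 (2008) 1989–2009, Prop. 3.2; [Bass1964] H. Bass, *K-theory and stable algebra*, Publ. IHÉS 22, §4
(stable range of semilocal rings); [Vaserstein1972SL2] L. N. Vaserstein, Mat. Sb. 89 (1972), p. 313 (`E(I₁,I₂) ⊆ G(I₁,I₂)`).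
-/

set_option linter.dupNamespace false
set_option autoImplicit false

namespace Summit.BirchSwinnertonDyer.BirchSwinnertonDyer.Theorems.Gamma0Parabolic

open scoped MatrixGroups
open CongruenceSubgroup Matrix.SpecialLinearGroup
open Literature.NumberTheory.Automorphic Literature.NumberTheory.Automorphic.SL2Rel

/-! ### §1 Row reduction over a commutative ring: unit corner ⟹ elementary (no new definitions) -/

section AnyRing

variable {R : Type*} [CommRing R]

/-- **The Whitehead-type word for a diagonal element congruent to `1`:** if `g = diag(u, v)` with `u ≡ 1 (mod n)`, say
`u = 1 + y n`, then `g = E₂₁(−n v) · E₁₂(y) · E₂₁(n) · E₁₂(−v y)`; hence `g ∈ E(R, (n)) = ⟨E₁₂(R), E₂₁((n))⟩`.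
[cite: Vaserstein1972SL2, p. 313] [cite: Bass1964, §4 (folklore row reduction)] -/
theorem mem_relE_of_offDiag_eq_zero (n : R) (g : SL(2, R)) (h01 : g 0 1 = 0) (h10 : g 1 0 = 0)
    (ha : g 0 0 - 1 ∈ Ideal.span {n}) : g ∈ relE (⊤ : Ideal R) (Ideal.span {n}) := by
  obtain ⟨y, hy⟩ := Ideal.mem_span_singleton'.1 ha
  have hdet : g 0 0 * g 1 1 - g 0 1 * g 1 0 = 1 := by
    have := g.prop; rwa [Matrix.det_fin_two] at this
  have h : g 0 0 * g 1 1 = 1 := by rw [h01, h10] at hdet; linear_combination hdet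
  have hu : g 0 0 = 1 + y * n := by linear_combination -hy
  have key : g = e21 (-(n * g 1 1)) * (e12 y * e21 n) * e12 (-(g 1 1 * y)) := by
    ext i j
    fin_cases i <;> fin_cases j <;> simp [mul_apply_two, h01, h10]
    · linear_combination hu
    · linear_combination -(g 1 1 * y) * hu + y * h
    · linear_combination -(n * g 1 1) * hu + n * h
    · linear_combination -(g 1 1 - n * g 1 1 ^ 2 * y) * hu - (n * g 1 1 * y - 1) * h
  have h12 : ∀ x : R, e12 x ∈ relE (⊤ : Ideal R) (Ideal.span {n}) := fun x =>
    e12_mem_relE (Submodule.mem_top : x ∈ (⊤ : Ideal R))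
  have h21 : ∀ z : R, e21 (z * n) ∈ relE (⊤ : Ideal R) (Ideal.span {n}) := fun z =>
    e21_mem_relE (Ideal.mem_span_singleton'.2 ⟨z, rfl⟩)
  rw [key]
  refine Subgroup.mul_mem _ (Subgroup.mul_mem _ ?_ (Subgroup.mul_mem _ (h12 y) ?_)) (h12 _)
  · have : -(n * g 1 1) = (-(g 1 1)) * n := by ring
    rw [this]; exact h21 _
  · simpa using h21 1

/-- **`G(R, (n)) ∩ {unit corner} ⊆ E(R, (n))`:** an element `g = (a b; c d)` of `SL₂(R)` with `c ∈ (n)`, `a ≡ 1 (mod n)`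
and `a` a UNIT is a product of upper elementary matrices and lower elementary matrices of level `n`: with `a w = 1`,
`E₂₁(−c w) · g · E₁₂(−w b)` is diagonal with corner `a`. [cite: Vaserstein1972SL2, p. 313] [cite: Bass1964, §4] -/
theorem mem_relE_of_isUnit_corner (n : R) (g : SL(2, R)) (hc : g 1 0 ∈ Ideal.span {n})
    (ha : g 0 0 - 1 ∈ Ideal.span {n}) (hunit : IsUnit (g 0 0)) :
    g ∈ relE (⊤ : Ideal R) (Ideal.span {n}) := by
  obtain ⟨w, hw⟩ := hunit.exists_right_inv
  set g' : SL(2, R) := e21 (-(g 1 0 * w)) * g * e12 (-(w * g 0 1)) with hg'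
  have h00 : g' 0 0 = g 0 0 := by simp [hg', mul_apply_two]
  have h01 : g' 0 1 = 0 := by
    simp [hg', mul_apply_two]; linear_combination (-(g 0 1)) * hw
  have h10 : g' 1 0 = 0 := by
    simp [hg', mul_apply_two]; linear_combination (-(g 1 0)) * hw
  have hmem : g' ∈ relE (⊤ : Ideal R) (Ideal.span {n}) :=
    mem_relE_of_offDiag_eq_zero n g' h01 h10 (by rw [h00]; exact ha)
  have hg : g = e21 (g 1 0 * w) * g' * e12 (w * g 0 1) := by
    rw [hg', e21_neg, e12_neg]; group
  rw [hg]
  refine Subgroup.mul_mem _ (Subgroup.mul_mem _ ?_ hmem) ?_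
  · exact e21_mem_relE (Ideal.mul_mem_right _ _ hc)
  · exact e12_mem_relE Submodule.mem_top

end AnyRing

/-! ### §2 Reduction mod `L`: the unit-corner case of Lemma E -/

section Level

variable (N : ℕ)

/-- `E(ℤ/L, (N)) ≤ ⟨Ē₁₂(1), Ē₂₁(N)⟩`: over `ℤ/L` every element is a multiple of `1`, so the elementary subgroup of level
`(ℤ/L, (N))` is generated by two elements. [cite: Vaserstein1972SL2, p. 313] -/
theorem relE_le_closure_pair (L : ℕ) [NeZero L] :
    relE (⊤ : Ideal (ZMod L)) (Ideal.span {((N : ℤ) : ZMod L)}) ≤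
      Subgroup.closure {e12 (1 : ZMod L), e21 ((N : ℤ) : ZMod L)} := by
  refine (Subgroup.closure_le _).2 ?_
  rintro g (⟨x, -, rfl⟩ | ⟨z, hz, rfl⟩)
  · have hx : (x : ZMod L) = x.val • (1 : ZMod L) := by
      rw [nsmul_eq_mul, mul_one, ZMod.natCast_zmod_val]
    rw [hx, e12_nsmul]
    exact Subgroup.pow_mem _ (Subgroup.subset_closure (by simp)) _
  · obtain ⟨r, rfl⟩ := Ideal.mem_span_singleton'.1 hz
    have hr : r * ((N : ℤ) : ZMod L) = r.val • ((N : ℤ) : ZMod L) := by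
      rw [nsmul_eq_mul, ZMod.natCast_zmod_val]
    rw [hr, e21_nsmul]
    exact Subgroup.pow_mem _ (Subgroup.subset_closure (by simp)) _

/-- `T = (1 1; 0 1)` lies in `Γ₀(N)`. [folklore] -/
theorem e12_one_mem_gamma0 : e12 (1 : ℤ) ∈ Gamma0 N := by simp [Gamma0_mem]

/-- `V_N = (1 0; N 1)` lies in `Γ₀(N)`. [folklore] -/
theorem e21_natCast_mem_gamma0 : e21 (N : ℤ) ∈ Gamma0 N := by simp [Gamma0_mem]

/-- `T = (1 1; 0 1)` lies in `Γ₁(N)`. [folklore] -/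
theorem e12_one_mem_gamma1 : (⟨e12 (1 : ℤ), e12_one_mem_gamma0 N⟩ : Gamma0 N) ∈ Gamma1' N := by
  simp [Gamma1_mem', Gamma0Map]

/-- The reductions mod `L` of the two parabolics generate a subgroup contained in the reduction of
`⟨T, V_N⟩ ≤ Γ₀(N)`. [folklore] -/
theorem closure_pair_le_map (L : ℕ) :
    Subgroup.closure {e12 (1 : ZMod L), e21 ((N : ℤ) : ZMod L)} ≤
      (Subgroup.closure {γ : Gamma0 N | (γ : SL(2, ℤ)) = e12 1 ∨ (γ : SL(2, ℤ)) = e21 (N : ℤ)}).map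
        ((Matrix.SpecialLinearGroup.map (Int.castRingHom (ZMod L))).comp (Gamma0 N).subtype) := by
  refine (Subgroup.closure_le _).2 ?_
  rintro g (rfl | rfl)
  · refine ⟨⟨e12 (1 : ℤ), e12_one_mem_gamma0 N⟩, Subgroup.subset_closure (Or.inl rfl), ?_⟩
    ext i j; fin_cases i <;> fin_cases j <;> simp
  · refine ⟨⟨e21 (N : ℤ), e21_natCast_mem_gamma0 N⟩, Subgroup.subset_closure (Or.inr rfl), ?_⟩
    ext i j; fin_cases i <;> fin_cases j <;> simp

/-- **Unit-corner case:** an element of `Γ₁(N)` whose corner `a` is prime to `L` lies in `(Γ₀(N) ∩ Γ(L)) · ⟨T, V_N⟩`.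
[cite: KurthLong2008, Prop. 3.2] -/
theorem mem_sup_of_isUnit_corner (L : ℕ) [NeZero L] (γ : Gamma0 N) (hγ : γ ∈ Gamma1' N)
    (hunit : IsUnit ((((γ : SL(2, ℤ)) 0 0 : ℤ)) : ZMod L)) :
    γ ∈ (Gamma L).comap (Gamma0 N).subtype ⊔
      Subgroup.closure {γ : Gamma0 N | (γ : SL(2, ℤ)) = e12 1 ∨ (γ : SL(2, ℤ)) = e21 (N : ℤ)} := by
  set red : Gamma0 N →* SL(2, ZMod L) :=
    (Matrix.SpecialLinearGroup.map (Int.castRingHom (ZMod L))).comp (Gamma0 N).subtype with hred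
  have hred_apply : ∀ (δ : Gamma0 N) (i j : Fin 2), red δ i j = (((δ : SL(2, ℤ)) i j : ℤ) : ZMod L) :=
    fun _ _ _ => rfl
  obtain ⟨ha, -, hc⟩ := (Gamma1_to_Gamma0_mem γ).1 hγ
  -- the reduction of `γ` lies in `G(ℤ/L, (N))` with a unit corner, hence in `E(ℤ/L, (N))`
  have hN : ∀ z : ℤ, ((z : ZMod N) = 0) → ((z : ZMod L) ∈ Ideal.span {((N : ℤ) : ZMod L)}) := by
    intro z hz
    obtain ⟨k, rfl⟩ := (ZMod.intCast_zmod_eq_zero_iff_dvd z N).1 hz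
    exact Ideal.mem_span_singleton'.2 ⟨(k : ZMod L), by push_cast; ring⟩
  have hmem : red γ ∈ relE (⊤ : Ideal (ZMod L)) (Ideal.span {((N : ℤ) : ZMod L)}) := by
    refine mem_relE_of_isUnit_corner _ _ ?_ ?_ ?_
    · rw [hred_apply]; exact hN _ hc
    · rw [hred_apply]
      have h1 : (((γ : SL(2, ℤ)) 0 0 : ℤ) : ZMod L) - 1 = (((γ : SL(2, ℤ)) 0 0 - 1 : ℤ) : ZMod L) := by
        push_cast; ring
      rw [h1]
      refine hN _ ?_
      push_cast; rw [ha]; ring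
    · rw [hred_apply]; exact hunit
  obtain ⟨η, hη, hηγ⟩ := Subgroup.mem_map.1 (closure_pair_le_map N L (relE_le_closure_pair N L hmem))
  have hk : γ * η⁻¹ ∈ (Gamma L).comap (Gamma0 N).subtype := by
    rw [Subgroup.mem_comap, Gamma_mem']
    have : red (γ * η⁻¹) = 1 := by rw [map_mul, map_inv, hηγ, mul_inv_cancel]
    exact this
  have : γ = γ * η⁻¹ * η := by group
  rw [this]
  exact Subgroup.mul_mem_sup hk hη

end Level

/-! ### §3 Making the corner prime to `L` inside the coset `⟨T⟩ γ` -/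

/-- **Coprime corner:** for coprime integers `a, c` and `L ≥ 1` some `a + x c` (`x ∈ ℕ`) is prime to `L`
(`x` = the product of the primes of `L` not dividing `a`). [folklore] -/
theorem exists_isUnit_add_mul (a c : ℤ) (hac : IsCoprime a c) (L : ℕ) (hL : L ≠ 0) :
    ∃ x : ℕ, IsUnit (((a + x * c : ℤ)) : ZMod L) := by
  classical
  set S : Finset ℕ := L.primeFactors.filter (fun q : ℕ => ¬ ((q : ℤ) ∣ a)) with hS
  refine ⟨∏ q ∈ S, q, ?_⟩
  rw [ZMod.coe_int_isUnit_iff_isCoprime, Int.isCoprime_iff_gcd_eq_one, Int.gcd_eq_natAbs,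
    Int.natAbs_natCast]
  refine Nat.Coprime.gcd_eq_one (Nat.coprime_of_dvd fun k hk hkL hka => ?_)
  have hkS : ∀ q ∈ S, q.Prime := fun q hq => (Nat.mem_primeFactors.1 (Finset.mem_filter.1 hq).1).1
  rw [← Int.ofNat_dvd_left] at hka
  have hkprime : Prime (k : ℤ) := Nat.prime_iff_prime_int.1 hk
  by_cases hdiv : (k : ℤ) ∣ a
  · -- then `k ∤ c` (coprime) and `k ∤ x` (all primes of `x` do not divide `a`), contradiction
    have hkc : ¬ (k : ℤ) ∣ c := by
      intro hkc
      have hu := hac.isUnit_of_dvd' hdiv hkc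
      rw [Int.isUnit_iff] at hu
      have := hk.two_le
      omega
    have hkx : ¬ (k : ℤ) ∣ ((∏ q ∈ S, q : ℕ) : ℤ) := by
      push_cast
      rw [hkprime.dvd_finsetProd_iff]
      rintro ⟨q, hq, hkq⟩
      have hkq' : k ∣ q := by exact_mod_cast hkq
      have hqk : k = q := (Nat.prime_dvd_prime_iff_eq hk (hkS q hq)).1 hkq'
      subst hqk
      exact (Finset.mem_filter.1 hq).2 hdiv
    have : (k : ℤ) ∣ ((∏ q ∈ S, q : ℕ) : ℤ) * c := by
      have := dvd_sub hka hdiv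
      simpa using this
    rcases hkprime.dvd_or_dvd this with h | h
    · exact hkx h
    · exact hkc h
  · -- then `k ∣ x`, so `k ∣ a`, contradiction
    have hkmem : k ∈ S := Finset.mem_filter.2 ⟨Nat.mem_primeFactors.2 ⟨hk, hkL, hL⟩, hdiv⟩
    have hkx : (k : ℤ) ∣ ((∏ q ∈ S, q : ℕ) : ℤ) := by
      push_cast
      exact Finset.dvd_prod_of_mem _ hkmem
    have : (k : ℤ) ∣ a := by
      have := dvd_sub hka (dvd_mul_of_dvd_left hkx c)
      simpa using this
    exact hdiv this

/-- The corner of `E₁₂(x) γ` is `a + x c`. [folklore] -/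
theorem e12_mul_apply_00 (x : ℤ) (g : SL(2, ℤ)) : (e12 x * g) 0 0 = g 0 0 + x * g 1 0 := by
  simp [mul_apply_two]

/-! ### §4 Lemma E -/

/-- **LEMMA E (subgroup form): `Γ₁(N) ⊆ (Γ₀(N) ∩ Γ(L)) · ⟨T, V_N⟩` for every `N` and every `L ≥ 1`**, where
`T = (1 1; 0 1)`, `V_N = (1 0; N 1)` are the two standard parabolics of `Γ₀(N)`.  Equivalently, the image of `Γ₁(N)` in
`SL₂(ℤ/L)` is generated by the images of `T` and `V_N`. [cite: KurthLong2008, Prop. 3.2] -/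
theorem gamma1_le_congruence_sup_closure_parabolics (N L : ℕ) (hL : 0 < L) :
    Gamma1' N ≤ (Gamma L).comap (Gamma0 N).subtype ⊔
      Subgroup.closure {γ : Gamma0 N | (γ : SL(2, ℤ)) = e12 1 ∨ (γ : SL(2, ℤ)) = e21 (N : ℤ)} := by
  haveI : NeZero L := ⟨hL.ne'⟩
  intro γ hγ
  have hdet : (γ : SL(2, ℤ)) 0 0 * (γ : SL(2, ℤ)) 1 1 - (γ : SL(2, ℤ)) 0 1 * (γ : SL(2, ℤ)) 1 0 = 1 := by
    have := (γ : SL(2, ℤ)).prop; rwa [Matrix.det_fin_two] at this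
  have hac : IsCoprime ((γ : SL(2, ℤ)) 0 0) ((γ : SL(2, ℤ)) 1 0) :=
    ⟨(γ : SL(2, ℤ)) 1 1, -((γ : SL(2, ℤ)) 0 1), by linear_combination hdet⟩
  obtain ⟨x, hx⟩ := exists_isUnit_add_mul _ _ hac L hL.ne'
  -- `T^x = E₁₂(x)` as an element of `Γ₀(N)`, inside `⟨T, V_N⟩` and inside `Γ₁(N)`
  set T : Gamma0 N := ⟨e12 (1 : ℤ), e12_one_mem_gamma0 N⟩ with hTdef
  have hTx : ((T ^ x : Gamma0 N) : SL(2, ℤ)) = e12 (x : ℤ) := by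
    rw [show ((T ^ x : Gamma0 N) : SL(2, ℤ)) = (T : SL(2, ℤ)) ^ x from rfl, hTdef,
      ← e12_nsmul, nsmul_eq_mul, mul_one]
  have hTmem : T ∈ ({γ : Gamma0 N | (γ : SL(2, ℤ)) = e12 1 ∨ (γ : SL(2, ℤ)) = e21 (N : ℤ)} :
      Set (Gamma0 N)) := Or.inl rfl
  have hT : T ^ x ∈ Subgroup.closure
      {γ : Gamma0 N | (γ : SL(2, ℤ)) = e12 1 ∨ (γ : SL(2, ℤ)) = e21 (N : ℤ)} :=
    Subgroup.pow_mem _ (Subgroup.subset_closure hTmem) x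
  have hγ' : T ^ x * γ ∈ Gamma1' N :=
    Subgroup.mul_mem _ (Subgroup.pow_mem _ (e12_one_mem_gamma1 N) x) hγ
  have hunit : IsUnit ((((T ^ x * γ : Gamma0 N) : SL(2, ℤ)) 0 0 : ℤ) : ZMod L) := by
    rw [show ((T ^ x * γ : Gamma0 N) : SL(2, ℤ)) = ((T ^ x : Gamma0 N) : SL(2, ℤ)) * γ from rfl, hTx,
      e12_mul_apply_00]
    exact hx
  have hmem := mem_sup_of_isUnit_corner N L _ hγ' hunit
  have : γ = (T ^ x)⁻¹ * (T ^ x * γ) := by group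
  rw [this]
  exact Subgroup.mul_mem _ (Subgroup.mem_sup_right (Subgroup.inv_mem _ hT)) hmem

/-- **LEMMA E (character form; Kurth–Long 2008 Prop. 3.2 in `Γ₀`-form):** a homomorphism `χ : Γ₀(N) → F` to any group
killing the parabolics `T = (1 1; 0 1)` and `V_N = (1 0; N 1)` and the congruence kernel `Γ₀(N) ∩ Γ(L)` of SOME level
`L ≥ 1` kills `Γ₁(N)` — it factors through `Γ₀(N)/Γ₁(N) ≅ (ℤ/N)ˣ` («Eisenstein»).  Contrapositive: a parabolic-trivial
(«type II») homomorphism non-trivial on `Γ₁(N)` — e.g. a cuspidal mod-`p` homology character of `X₀(N)` — has a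
NON-CONGRUENCE kernel. [cite: KurthLong2008, Prop. 3.2] -/
theorem map_eq_one_of_parabolic_of_congruence {N L : ℕ} (hL : 0 < L) {F : Type*} [Group F] (χ : Gamma0 N →* F)
    (hpar : ∀ γ : Gamma0 N, (γ : SL(2, ℤ)) = e12 1 ∨ (γ : SL(2, ℤ)) = e21 (N : ℤ) → χ γ = 1)
    (hcong : ∀ γ : Gamma0 N, (γ : SL(2, ℤ)) ∈ Gamma L → χ γ = 1) :
    ∀ γ ∈ Gamma1' N, χ γ = 1 := by
  intro γ hγ
  have hle : (Gamma L).comap (Gamma0 N).subtype ⊔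
      Subgroup.closure {γ : Gamma0 N | (γ : SL(2, ℤ)) = e12 1 ∨ (γ : SL(2, ℤ)) = e21 (N : ℤ)} ≤ χ.ker :=
    sup_le (fun δ hδ => hcong δ hδ) ((Subgroup.closure_le _).2 fun δ hδ => hpar δ hδ)
  exact hle (gamma1_le_congruence_sup_closure_parabolics N L hL hγ)

/-- **LEMMA E for trace-`±2`-trivial characters** (the literal shape of bsd-idea-17's `FwSolenoid.LemmaE`: `IsTypeII` =
kills every element of trace `2` or `−2`; `IsCongruenceTrivial N L` = kills `Γ₀(N) ∩ Γ(L)`; `IsEisenstein` = kills `Γ₁(N)`).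
[cite: KurthLong2008, Prop. 3.2] -/
theorem map_eq_one_of_traceTwo_of_congruence {N L : ℕ} (hL : 0 < L) {F : Type*} [Group F] (χ : Gamma0 N →* F)
    (htr : ∀ γ : Gamma0 N,
      ((γ : SL(2, ℤ)) 0 0 + (γ : SL(2, ℤ)) 1 1 = 2 ∨ (γ : SL(2, ℤ)) 0 0 + (γ : SL(2, ℤ)) 1 1 = -2) → χ γ = 1)
    (hcong : ∀ γ : Gamma0 N, (γ : SL(2, ℤ)) ∈ Gamma L → χ γ = 1) :
    ∀ γ : Gamma0 N, γ ∈ Gamma1' N → χ γ = 1 := by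
  refine map_eq_one_of_parabolic_of_congruence hL χ (fun γ hγ => htr γ (Or.inl ?_)) hcong
  rcases hγ with h | h <;> rw [h] <;> norm_num

/-- **Additive form** (mod-`p` homology characters are additive maps `Γ₀(N) → 𝔽_p`): an additive `u : Γ₀(N) → A` killing
`T`, `V_N` and `Γ₀(N) ∩ Γ(L)` kills `Γ₁(N)`. [cite: KurthLong2008, Prop. 3.2] -/
theorem additive_eq_zero_of_parabolic_of_congruence {N L : ℕ} (hL : 0 < L) {A : Type*} [AddGroup A]
    (u : Gamma0 N → A) (hu : ∀ g h : Gamma0 N, u (g * h) = u g + u h)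
    (hpar : ∀ γ : Gamma0 N, (γ : SL(2, ℤ)) = e12 1 ∨ (γ : SL(2, ℤ)) = e21 (N : ℤ) → u γ = 0)
    (hcong : ∀ γ : Gamma0 N, (γ : SL(2, ℤ)) ∈ Gamma L → u γ = 0) :
    ∀ γ ∈ Gamma1' N, u γ = 0 := by
  let χ : Gamma0 N →* Multiplicative A :=
    { toFun := fun g => Multiplicative.ofAdd (u g)
      map_one' := by
        have h1 : u 1 = 0 := by
          have := hu 1 1; rw [one_mul] at this
          have h2 : u 1 + u 1 = u 1 + 0 := by rw [add_zero]; exact this.symm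
          exact add_left_cancel h2
        simp [h1]
      map_mul' := fun g h => by simp [hu, ofAdd_add] }
  intro γ hγ
  have := map_eq_one_of_parabolic_of_congruence hL χ (fun δ hδ => by simp [χ, hpar δ hδ])
    (fun δ hδ => by simp [χ, hcong δ hδ]) γ hγ
  simpa [χ] using this

end Summit.BirchSwinnertonDyer.BirchSwinnertonDyer.Theorems.Gamma0Parabolic
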